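import Summits.NavierStokesRegularity.NavierStokesRegularity.Theses.FilamentSkeletonRss
import Literature.Analysis.FluidPDE.GaussianWeightedSpace

/-!
# Tools for stub `stub_classClosure` (crux `CoreLinearInvertibility`, stmt-NavierStokesRegularity-17973,
# route `FilamentSkeletonRss`, line `Sketch`) — part A: weighted `L²` convergence

The class-closure stub transports the a-priori bound `c²‖w‖²_{X_λ} ≤ ‖T w‖²_{X_λ}` from `C²_c`
zero-moment vorticities to the maximal-domain class; all it needs is a sequence of `C²_c`
approximants whose two squared weighted norms converge. This file supplies the measure-theoretic
part, for the weight `g = G_λ⁻¹`, `G_λ = gaussWeightLam λ` (Gallay–Maekawa's `X_λ = L²(∞;λ)`):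

* a weighted Cauchy–Schwarz inequality `|∫ g a b| ≤ (∫ g a²)^{1/2} (∫ g b²)^{1/2}` and its
  consequence: `∫ g (F_k − f)² → 0` implies `∫ g F_k² → ∫ g f²` (`tendsto_integral_weight_mul_sq`);
* "`φ_k → 0` in `X_λ`" as the conjunction `X φ` of measurability, `G_λ⁻¹ φ_k² ∈ L¹` and
  `∫ G_λ⁻¹ φ_k² → 0` (kept abstract through a section hypothesis `hX`, no new definition), and its
  closure under sums, constants, scalar sequences tending to zero, domination (dominated
  convergence) and explicit bounds; `tendsto_of_xconv` turns `X (F − f)` into `‖F_k‖² → ‖f‖²`.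

References: Th. Gallay, Y. Maekawa, arXiv:1610.08384, §4.1 (4.5)–(4.6) (the space `L²(∞;λ)`);
the estimates are folklore.
-/

set_option linter.dupNamespace false

noncomputable section

namespace Summit.NavierStokesRegularity.NavierStokesRegularity.Theorems

open Set Function Filter MeasureTheory Topology
open Literature.Analysis.FluidPDE
open scoped InnerProductSpace

/-! ### Weighted Cauchy–Schwarz and convergence of weighted squares -/

section Weighted

variable {α : Type*} [MeasurableSpace α] {μ : Measure α}

/-- Weighted Cauchy–Schwarz: for a weight `g ≥ 0` and `g a², g b² ∈ L¹`, the product `g a b` is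
integrable and `|∫ g a b| ≤ (∫ g a²)^{1/2} (∫ g b²)^{1/2}`. [folklore] -/
theorem abs_integral_weight_mul_mul_le {g a b : α → ℝ} (hg : ∀ x, 0 ≤ g x)
    (hgm : AEStronglyMeasurable g μ) (ham : AEStronglyMeasurable a μ)
    (hbm : AEStronglyMeasurable b μ) (ha : Integrable (fun x => g x * a x ^ 2) μ)
    (hb : Integrable (fun x => g x * b x ^ 2) μ) :
    Integrable (fun x => g x * (a x * b x)) μ ∧
      |∫ x, g x * (a x * b x) ∂μ| ≤
        Real.sqrt (∫ x, g x * a x ^ 2 ∂μ) * Real.sqrt (∫ x, g x * b x ^ 2 ∂μ) := by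
  have hint : Integrable (fun x => g x * (a x * b x)) μ := by
    refine Integrable.mono' ((ha.add hb).div_const 2) (hgm.mul (ham.mul hbm))
      (Eventually.of_forall fun x => ?_)
    rw [Real.norm_eq_abs, abs_mul, abs_of_nonneg (hg x), abs_mul]
    change g x * (|a x| * |b x|) ≤ (g x * a x ^ 2 + g x * b x ^ 2) / 2
    have h0 := hg x
    nlinarith [mul_nonneg h0 (sq_nonneg (|a x| - |b x|)), sq_abs (a x), sq_abs (b x)]
  refine ⟨hint, ?_⟩
  have hsm : AEStronglyMeasurable (fun x => Real.sqrt (g x)) μ :=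
    Real.continuous_sqrt.comp_aestronglyMeasurable hgm
  have hFm : AEStronglyMeasurable (fun x => Real.sqrt (g x) * |a x|) μ :=
    hsm.mul (continuous_abs.comp_aestronglyMeasurable ham)
  have hGm : AEStronglyMeasurable (fun x => Real.sqrt (g x) * |b x|) μ :=
    hsm.mul (continuous_abs.comp_aestronglyMeasurable hbm)
  have hsqa : ∀ x, (Real.sqrt (g x) * |a x|) ^ 2 = g x * a x ^ 2 := fun x => by
    rw [mul_pow, Real.sq_sqrt (hg x), sq_abs]
  have hsqb : ∀ x, (Real.sqrt (g x) * |b x|) ^ 2 = g x * b x ^ 2 := fun x => by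
    rw [mul_pow, Real.sq_sqrt (hg x), sq_abs]
  have hF : MemLp (fun x => Real.sqrt (g x) * |a x|) (ENNReal.ofReal 2) μ := by
    rw [ENNReal.ofReal_ofNat, memLp_two_iff_integrable_sq hFm]
    simp_rw [hsqa]
    exact ha
  have hG : MemLp (fun x => Real.sqrt (g x) * |b x|) (ENNReal.ofReal 2) μ := by
    rw [ENNReal.ofReal_ofNat, memLp_two_iff_integrable_sq hGm]
    simp_rw [hsqb]
    exact hb
  have hCS := integral_mul_le_Lp_mul_Lq_of_nonneg Real.HolderConjugate.two_two
    (Eventually.of_forall fun x => mul_nonneg (Real.sqrt_nonneg _) (abs_nonneg _))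
    (Eventually.of_forall fun x => mul_nonneg (Real.sqrt_nonneg _) (abs_nonneg _)) hF hG
  have h1 : ∀ x, Real.sqrt (g x) * |a x| * (Real.sqrt (g x) * |b x|) = |g x * (a x * b x)| :=
    fun x => by
    rw [abs_mul, abs_mul, abs_of_nonneg (hg x)]
    calc Real.sqrt (g x) * |a x| * (Real.sqrt (g x) * |b x|)
        = (Real.sqrt (g x) * Real.sqrt (g x)) * (|a x| * |b x|) := by ring
      _ = g x * (|a x| * |b x|) := by rw [Real.mul_self_sqrt (hg x)]
  have h2a : ∀ x, (Real.sqrt (g x) * |a x|) ^ (2 : ℝ) = g x * a x ^ 2 := fun x => by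
    rw [Real.rpow_two, hsqa]
  have h2b : ∀ x, (Real.sqrt (g x) * |b x|) ^ (2 : ℝ) = g x * b x ^ 2 := fun x => by
    rw [Real.rpow_two, hsqb]
  simp_rw [h1, h2a, h2b, ← Real.sqrt_eq_rpow] at hCS
  exact (abs_integral_le_integral_abs).trans hCS

/-- If `∫ g (F_k − f)² → 0` for a weight `g ≥ 0` with `g f² ∈ L¹`, then `∫ g F_k² → ∫ g f²`
(`|∫ g F_k² − ∫ g f²| ≤ D_k + 2 D_k^{1/2} (∫ g f²)^{1/2}`, `D_k = ∫ g (F_k − f)²`). [folklore] -/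
theorem tendsto_integral_weight_mul_sq {g f : α → ℝ} {F : ℕ → α → ℝ} (hg : ∀ x, 0 ≤ g x)
    (hgm : AEStronglyMeasurable g μ) (hfm : AEStronglyMeasurable f μ)
    (hFm : ∀ k, AEStronglyMeasurable (F k) μ) (hf : Integrable (fun x => g x * f x ^ 2) μ)
    (hF : ∀ k, Integrable (fun x => g x * (F k x - f x) ^ 2) μ)
    (hlim : Tendsto (fun k => ∫ x, g x * (F k x - f x) ^ 2 ∂μ) atTop (𝓝 0)) :
    Tendsto (fun k => ∫ x, g x * F k x ^ 2 ∂μ) atTop (𝓝 (∫ x, g x * f x ^ 2 ∂μ)) := by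
  have hcross : ∀ k, Integrable (fun x => g x * ((F k x - f x) * f x)) μ ∧
      |∫ x, g x * ((F k x - f x) * f x) ∂μ| ≤
        Real.sqrt (∫ x, g x * (F k x - f x) ^ 2 ∂μ) * Real.sqrt (∫ x, g x * f x ^ 2 ∂μ) :=
    fun k => abs_integral_weight_mul_mul_le hg hgm ((hFm k).sub hfm) hfm (hF k) hf
  have hFk : ∀ k, Integrable (fun x => g x * F k x ^ 2) μ := fun k => by
    have : (fun x => g x * F k x ^ 2) = fun x =>
        g x * (F k x - f x) ^ 2 + 2 * (g x * ((F k x - f x) * f x)) + g x * f x ^ 2 := by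
      funext x; ring
    rw [this]
    exact ((hF k).add ((hcross k).1.const_mul 2)).add hf
  have hdiff : ∀ k, (∫ x, g x * F k x ^ 2 ∂μ) - ∫ x, g x * f x ^ 2 ∂μ =
      (∫ x, g x * (F k x - f x) ^ 2 ∂μ) + 2 * ∫ x, g x * ((F k x - f x) * f x) ∂μ := fun k => by
    rw [← integral_const_mul, ← integral_add (hF k) ((hcross k).1.const_mul 2),
      ← integral_sub (hFk k) hf]
    refine integral_congr_ae (Eventually.of_forall fun x => ?_)
    simp only
    ring
  rw [tendsto_iff_norm_sub_tendsto_zero]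
  refine squeeze_zero (fun k => norm_nonneg _)
    (g := fun k => (∫ x, g x * (F k x - f x) ^ 2 ∂μ) +
      2 * (Real.sqrt (∫ x, g x * (F k x - f x) ^ 2 ∂μ) * Real.sqrt (∫ x, g x * f x ^ 2 ∂μ)))
    (fun k => ?_) ?_
  · rw [Real.norm_eq_abs, hdiff]
    have h0 : 0 ≤ ∫ x, g x * (F k x - f x) ^ 2 ∂μ :=
      integral_nonneg fun x => mul_nonneg (hg x) (sq_nonneg _)
    calc |(∫ x, g x * (F k x - f x) ^ 2 ∂μ) + 2 * ∫ x, g x * ((F k x - f x) * f x) ∂μ|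
        ≤ |∫ x, g x * (F k x - f x) ^ 2 ∂μ| + |2 * ∫ x, g x * ((F k x - f x) * f x) ∂μ| :=
          abs_add_le _ _
      _ ≤ (∫ x, g x * (F k x - f x) ^ 2 ∂μ) +
          2 * (Real.sqrt (∫ x, g x * (F k x - f x) ^ 2 ∂μ) * Real.sqrt (∫ x, g x * f x ^ 2 ∂μ)) := by
          rw [abs_of_nonneg h0, abs_mul, abs_two]
          have := (hcross k).2
          nlinarith [(hcross k).2]
  · have hs : Tendsto (fun k => Real.sqrt (∫ x, g x * (F k x - f x) ^ 2 ∂μ)) atTop (𝓝 0) := by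
      simpa using hlim.sqrt
    simpa using hlim.add ((hs.mul_const (Real.sqrt (∫ x, g x * f x ^ 2 ∂μ))).const_mul 2)

end Weighted

/-! ### The weight `g = G_λ⁻¹` and convergence to zero in `X_λ` -/

/-- `G_λ` is continuous. [folklore] -/
theorem continuous_gaussWeightLam (lam : ℝ) : Continuous (gaussWeightLam lam) := by
  change Continuous fun x : EuclideanSpace ℝ (Fin 2) =>
    (1 - lam) / (4 * Real.pi) * Real.exp (-((1 - lam) / 4 * ‖x‖ ^ 2))
  fun_prop

/-- `G_λ⁻¹` is continuous for `λ < 1`. [folklore] -/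
theorem continuous_inv_gaussWeightLam {lam : ℝ} (hlam : lam < 1) :
    Continuous fun x => (gaussWeightLam lam x)⁻¹ :=
  (continuous_gaussWeightLam lam).inv₀ fun x => (gaussWeightLam_pos hlam x).ne'

section XConvLemmas

/-! Throughout this section `X φ` abbreviates "`φ_k → 0` in `X_λ`": the conjunction of
measurability of every `φ_k`, integrability of `G_λ⁻¹ φ_k²`, and `∫ G_λ⁻¹ φ_k² → 0`
(hypothesis `hX`; instantiate `X` with that conjunction and `hX := fun _ => Iff.rfl`). -/

variable {lam : ℝ} {φ ψ : ℕ → EuclideanSpace ℝ (Fin 2) → ℝ}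
  {X : (ℕ → EuclideanSpace ℝ (Fin 2) → ℝ) → Prop}
  (hX : ∀ φ : ℕ → EuclideanSpace ℝ (Fin 2) → ℝ, X φ ↔
    ((∀ k, AEStronglyMeasurable (φ k) volume) ∧
      (∀ k, Integrable (fun x => (gaussWeightLam lam x)⁻¹ * φ k x ^ 2)) ∧
        Tendsto (fun k => ∫ x, (gaussWeightLam lam x)⁻¹ * φ k x ^ 2) atTop (𝓝 0)))
include hX

/-- `X_λ`-convergence to zero is stable under sums (`(a+b)² ≤ 2a² + 2b²`). [folklore] -/
theorem xconv_add (hlam : lam < 1) (hφ : X φ) (hψ : X ψ) : X (fun k x => φ k x + ψ k x) := by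
  rw [hX] at hφ hψ ⊢
  obtain ⟨hφm, hφi, hφt⟩ := hφ
  obtain ⟨hψm, hψi, hψt⟩ := hψ
  have hg : ∀ x, 0 ≤ (gaussWeightLam lam x)⁻¹ := fun x => inv_nonneg.2 (gaussWeightLam_pos hlam x).le
  have hle : ∀ k x, (gaussWeightLam lam x)⁻¹ * (φ k x + ψ k x) ^ 2 ≤
      2 * ((gaussWeightLam lam x)⁻¹ * φ k x ^ 2) + 2 * ((gaussWeightLam lam x)⁻¹ * ψ k x ^ 2) :=
    fun k x => by nlinarith [mul_nonneg (hg x) (sq_nonneg (φ k x - ψ k x))]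
  have hint : ∀ k, Integrable (fun x => (gaussWeightLam lam x)⁻¹ * (φ k x + ψ k x) ^ 2) := fun k =>
    Integrable.mono' (((hφi k).const_mul 2).add ((hψi k).const_mul 2))
      ((continuous_inv_gaussWeightLam hlam).aestronglyMeasurable.mul (((hφm k).add (hψm k)).pow 2))
      (Eventually.of_forall fun x => by
        rw [Real.norm_of_nonneg (mul_nonneg (hg x) (sq_nonneg _))]
        exact hle k x)
  refine ⟨fun k => (hφm k).add (hψm k), hint, ?_⟩
  have hup : ∀ k, ∫ x, (gaussWeightLam lam x)⁻¹ * (φ k x + ψ k x) ^ 2 ≤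
      2 * (∫ x, (gaussWeightLam lam x)⁻¹ * φ k x ^ 2) +
        2 * ∫ x, (gaussWeightLam lam x)⁻¹ * ψ k x ^ 2 := fun k => by
    rw [← integral_const_mul, ← integral_const_mul,
      ← integral_add ((hφi k).const_mul 2) ((hψi k).const_mul 2)]
    exact integral_mono (hint k) (((hφi k).const_mul 2).add ((hψi k).const_mul 2)) (hle k)
  refine squeeze_zero (fun k => integral_nonneg fun x => mul_nonneg (hg x) (sq_nonneg _)) hup ?_
  simpa using (hφt.const_mul 2).add (hψt.const_mul 2)

/-- `X_λ`-convergence to zero is stable under multiplication by a constant. [folklore] -/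
theorem xconv_const_mul (c : ℝ) (hφ : X φ) : X (fun k x => c * φ k x) := by
  rw [hX] at hφ ⊢
  obtain ⟨hφm, hφi, hφt⟩ := hφ
  have heq : ∀ k, (fun x => (gaussWeightLam lam x)⁻¹ * (c * φ k x) ^ 2) =
      fun x => c ^ 2 * ((gaussWeightLam lam x)⁻¹ * φ k x ^ 2) := fun k => by
    funext x; ring
  refine ⟨fun k => (hφm k).const_mul c, fun k => ?_, ?_⟩
  · rw [heq k]; exact (hφi k).const_mul _
  · simp_rw [heq, integral_const_mul]
    simpa using hφt.const_mul (c ^ 2)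

/-- `X_λ`-convergence to zero is stable under differences. [folklore] -/
theorem xconv_sub (hlam : lam < 1) (hφ : X φ) (hψ : X ψ) : X (fun k x => φ k x - ψ k x) := by
  have h := xconv_add hX hlam hφ (xconv_const_mul hX (-1) hψ)
  simp only [neg_mul, one_mul, ← sub_eq_add_neg] at h
  exact h

/-- **Dominated convergence in `X_λ`**: `|φ_k| ≤ P` with `G_λ⁻¹P² ∈ L¹` and `φ_k → 0` pointwise
give `X_λ`-convergence to zero. [folklore] -/
theorem xconv_of_dominated (hlam : lam < 1) {P : EuclideanSpace ℝ (Fin 2) → ℝ}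
    (hφm : ∀ k, AEStronglyMeasurable (φ k) volume)
    (hP : Integrable (fun x => (gaussWeightLam lam x)⁻¹ * P x ^ 2))
    (hle : ∀ k x, |φ k x| ≤ P x) (hlim : ∀ x, Tendsto (fun k => φ k x) atTop (𝓝 0)) : X φ := by
  rw [hX]
  have hg : ∀ x, 0 ≤ (gaussWeightLam lam x)⁻¹ := fun x => inv_nonneg.2 (gaussWeightLam_pos hlam x).le
  have hpt : ∀ k x, (gaussWeightLam lam x)⁻¹ * φ k x ^ 2 ≤ (gaussWeightLam lam x)⁻¹ * P x ^ 2 :=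
    fun k x => mul_le_mul_of_nonneg_left
      (by rw [← sq_abs (φ k x)]; exact pow_le_pow_left₀ (abs_nonneg _) (hle k x) 2) (hg x)
  have hFm : ∀ k, AEStronglyMeasurable (fun x => (gaussWeightLam lam x)⁻¹ * φ k x ^ 2) volume :=
    fun k => (continuous_inv_gaussWeightLam hlam).aestronglyMeasurable.mul ((hφm k).pow 2)
  have hnorm : ∀ k x, ‖(gaussWeightLam lam x)⁻¹ * φ k x ^ 2‖ ≤ (gaussWeightLam lam x)⁻¹ * P x ^ 2 :=
    fun k x => by
    rw [Real.norm_of_nonneg (mul_nonneg (hg x) (sq_nonneg _))]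
    exact hpt k x
  refine ⟨hφm, fun k => hP.mono' (hFm k) (Eventually.of_forall (hnorm k)), ?_⟩
  have h := tendsto_integral_of_dominated_convergence (fun x => (gaussWeightLam lam x)⁻¹ * P x ^ 2)
    hFm hP (fun k => Eventually.of_forall (hnorm k))
    (Eventually.of_forall fun x =>
      (((hlim x).pow 2).const_mul ((gaussWeightLam lam x)⁻¹) :
        Tendsto (fun k => (gaussWeightLam lam x)⁻¹ * φ k x ^ 2) atTop
          (𝓝 ((gaussWeightLam lam x)⁻¹ * (0 : ℝ) ^ 2))))
  simpa using h

/-- A scalar sequence tending to zero times a fixed element of `X_λ` converges to zero in `X_λ`.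
[folklore] -/
theorem xconv_mul_of_tendsto_zero {m : ℕ → ℝ} {ψ₀ : EuclideanSpace ℝ (Fin 2) → ℝ}
    (hm : Tendsto m atTop (𝓝 0)) (hψm : AEStronglyMeasurable ψ₀ volume)
    (hψ : Integrable (fun x => (gaussWeightLam lam x)⁻¹ * ψ₀ x ^ 2)) :
    X (fun k x => m k * ψ₀ x) := by
  rw [hX]
  have heq : ∀ k, (fun x => (gaussWeightLam lam x)⁻¹ * (m k * ψ₀ x) ^ 2) =
      fun x => m k ^ 2 * ((gaussWeightLam lam x)⁻¹ * ψ₀ x ^ 2) := fun k => by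
    funext x; ring
  refine ⟨fun k => hψm.const_mul (m k), fun k => ?_, ?_⟩
  · rw [heq k]; exact hψ.const_mul _
  · simp_rw [heq, integral_const_mul]
    simpa using (hm.pow 2).mul_const (∫ x, (gaussWeightLam lam x)⁻¹ * ψ₀ x ^ 2)

/-- An explicit bound `∫ G_λ⁻¹ φ_k² ≤ c_k → 0` gives `X_λ`-convergence to zero. [folklore] -/
theorem xconv_of_integral_le (hlam : lam < 1) {c : ℕ → ℝ}
    (hφm : ∀ k, AEStronglyMeasurable (φ k) volume)
    (hφi : ∀ k, Integrable (fun x => (gaussWeightLam lam x)⁻¹ * φ k x ^ 2))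
    (hle : ∀ k, ∫ x, (gaussWeightLam lam x)⁻¹ * φ k x ^ 2 ≤ c k) (hc : Tendsto c atTop (𝓝 0)) :
    X φ :=
  (hX φ).2 ⟨hφm, hφi, squeeze_zero (fun _ => integral_nonneg fun x =>
    mul_nonneg (inv_nonneg.2 (gaussWeightLam_pos hlam x).le) (sq_nonneg _)) hle hc⟩

/-- **From `X_λ`-convergence to convergence of the squared norms**: if `F_k − f → 0` in `X_λ` and
`f ∈ X_λ` then `‖F_k‖²_{X_λ} → ‖f‖²_{X_λ}`. [folklore] -/
theorem tendsto_of_xconv (hlam : lam < 1) {F : ℕ → EuclideanSpace ℝ (Fin 2) → ℝ}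
    {f : EuclideanSpace ℝ (Fin 2) → ℝ} (hfm : AEStronglyMeasurable f volume)
    (hf : Integrable (fun x => (gaussWeightLam lam x)⁻¹ * f x ^ 2))
    (h : X (fun k x => F k x - f x)) :
    Tendsto (fun k => ∫ x, (gaussWeightLam lam x)⁻¹ * F k x ^ 2) atTop
      (𝓝 (∫ x, (gaussWeightLam lam x)⁻¹ * f x ^ 2)) := by
  rw [hX] at h
  obtain ⟨hdm, hdi, hdt⟩ := h
  have hFm : ∀ k, AEStronglyMeasurable (F k) volume := fun k => by
    have : F k = fun x => (F k x - f x) + f x := by funext x; ring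
    rw [this]
    exact (hdm k).add hfm
  exact tendsto_integral_weight_mul_sq (fun x => inv_nonneg.2 (gaussWeightLam_pos hlam x).le)
    (continuous_inv_gaussWeightLam hlam).aestronglyMeasurable hfm hFm hf hdi hdt

end XConvLemmas

/-- **Registered tools stub `stub_classClosureToolsA`** (helpers for `stub_classClosure`, line
`Sketch` of crux `CoreLinearInvertibility`, stmt-NavierStokesRegularity-17973): the weighted
Cauchy–Schwarz inequality and the convergence of weighted squares on `ℝ²`. [folklore] -/
theorem stub_classClosureToolsA :
    (∀ (g a b : EuclideanSpace ℝ (Fin 2) → ℝ), (∀ x, 0 ≤ g x) → AEStronglyMeasurable g volume →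
      AEStronglyMeasurable a volume → AEStronglyMeasurable b volume →
      Integrable (fun x => g x * a x ^ 2) → Integrable (fun x => g x * b x ^ 2) →
      Integrable (fun x => g x * (a x * b x)) ∧
        |∫ x, g x * (a x * b x)| ≤ Real.sqrt (∫ x, g x * a x ^ 2) * Real.sqrt (∫ x, g x * b x ^ 2)) ∧
    (∀ (g f : EuclideanSpace ℝ (Fin 2) → ℝ) (F : ℕ → EuclideanSpace ℝ (Fin 2) → ℝ), (∀ x, 0 ≤ g x) →
      AEStronglyMeasurable g volume → AEStronglyMeasurable f volume →
      (∀ k, AEStronglyMeasurable (F k) volume) → Integrable (fun x => g x * f x ^ 2) →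
      (∀ k, Integrable (fun x => g x * (F k x - f x) ^ 2)) →
      Tendsto (fun k => ∫ x, g x * (F k x - f x) ^ 2) atTop (𝓝 0) →
      Tendsto (fun k => ∫ x, g x * F k x ^ 2) atTop (𝓝 (∫ x, g x * f x ^ 2))) :=
  ⟨fun _ _ _ hg hgm ham hbm ha hb => abs_integral_weight_mul_mul_le hg hgm ham hbm ha hb,
    fun _ _ _ hg hgm hfm hFm hf hF hlim => tendsto_integral_weight_mul_sq hg hgm hfm hFm hf hF hlim⟩

end Summit.NavierStokesRegularity.NavierStokesRegularity.Theorems
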